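import Literature.Topology.FourManifolds.LeeRasmussenVanishingProofs
import Literature.Topology.FourManifolds.KhComplexDSquaredProofs
import HarnessLib

/-!
# Lee's theorem off degree zero: discharge of `isZero_leeHomology_of_ne_zero`

Sibling proof file of `LeeRasmussen.lean` (topic `Literature/Topology/FourManifolds`). It
discharges the named fact
`Literature.Topology.FourManifolds.GaussDiagram.isZero_leeHomology_of_ne_zero`:

* `isZero_leeHomology_of_ne_zero_holds` — **for a Gauss diagram realised by a knot, Lee homology
  `Kh'ⁱ` vanishes in every homological degree `i ≠ 0`** (E. S. Lee, *An endomorphism of the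
  Khovanov invariant*, Adv. Math. 197 (2005), Thm. 4.2 with Prop. 4.3: for a knot both canonical
  generators of Lee homology live in the degree of the oriented resolution; Rasmussen (2010),
  Prop. 2.3).

The algebra is `isZero_leeHomology_of_ne_zero_of_dichotomy` (`LeeRasmussenVanishingProofs.lean`:
Lee's change of basis `a = X + 1`, `b = X - 1`, the label decomposition of the complex, the
contraction off the generators without free chord, and the location of those generators over
the oriented resolution through Gauss's parity condition); the planarity input, the merge/split
dichotomy for realisable diagrams, is `isMergeAt_or_isSplitAt_of_hasGaussDiagram_holds`
(`KhComplexDSquaredProofs.lean`: Gauss's parity condition for regular projections,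
`RegularProjectionParity.lean`, by winding numbers, and parity ⇒ dichotomy,
`KhResolutionsDichotomyProofs.lean`).

## References

* E. S. Lee, *An endomorphism of the Khovanov invariant*, Adv. Math. 197 (2005) 554–586,
  Thm. 4.2, Prop. 4.3. [cite: Lee2005, Thm. 4.2]
* J. Rasmussen, *Khovanov homology and the slice genus*, Invent. Math. 182 (2010) 419–447,
  Prop. 2.3. [cite: Rasmussen2010, Prop. 2.3]
-/

noncomputable section

namespace Literature.Topology.FourManifolds

namespace GaussDiagram

/-- **Lee's theorem, other degrees (discharge of the named fact
`isZero_leeHomology_of_ne_zero`).** For a Gauss diagram realised by a knot, Lee homology vanishes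
in every homological degree `i ≠ 0`. Lee (2005), Thm. 4.2, Prop. 4.3; Rasmussen (2010),
Prop. 2.3. [cite: Lee2005, Thm. 4.2] -/
theorem isZero_leeHomology_of_ne_zero_holds : isZero_leeHomology_of_ne_zero :=
  isZero_leeHomology_of_ne_zero_of_dichotomy fun G ↦ @isMergeAt_or_isSplitAt_of_hasGaussDiagram_holds G

end GaussDiagram

end Literature.Topology.FourManifolds
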